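import Summits.ResolutionOfSingularities.ResolutionOfSingularities.Theorems.FrobeniusClosingDefs
import Literature.AlgebraicGeometry.Resolution.FiniteDeterminacyProofs

/-!
# Crux `ClosingReduction` — line `chart-factorization`, stub `stub_thm21BGM`

The registered stub `stub_thm21BGM : BoubakriGreuelMarkwig.Thm21` names the EXTERNAL published
statement the line consumes: Boubakri–Greuel–Markwig, *Invariants of hypersurface singularities in
positive characteristic*, Rev. Mat. Complut. 25 (2012), Thm 2.1 (finite determinacy in any
characteristic), vendored as the named fact
`Literature.AlgebraicGeometry.Resolution.BoubakriGreuelMarkwig.Thm21` in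
`Literature/AlgebraicGeometry/Resolution/FiniteDeterminacy.lean` and DISCHARGED in
`Literature/AlgebraicGeometry/Resolution/FiniteDeterminacyProofs.lean` (`Thm21_holds`, p167695).
This file closes the stub by that discharge.
-/

noncomputable section

-- single-problem summit: the doubled namespace component `ResolutionOfSingularities` is forced
set_option linter.dupNamespace false

open Literature.AlgebraicGeometry.Resolution (BoubakriGreuelMarkwig.Thm21)

namespace Summit.ResolutionOfSingularities.ResolutionOfSingularities.Theorems.FrobeniusClosing

/-- **STUB `stub_thm21BGM` (registered signature).** Boubakri–Greuel–Markwig Thm 2.1, by its landed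
Literature discharge `BoubakriGreuelMarkwig.Thm21_holds`. [cite: BoubakriGreuelMarkwig2010, Thm. 2.1] -/
theorem stub_thm21BGM : BoubakriGreuelMarkwig.Thm21 :=
  Literature.AlgebraicGeometry.Resolution.BoubakriGreuelMarkwig.Thm21_holds

end Summit.ResolutionOfSingularities.ResolutionOfSingularities.Theorems.FrobeniusClosing

end
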